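import Summits.QuantumFields.YangMills.Theorems.SwapVirialDeficitSectorLaplaceMbDensityFloorDet
import Summits.QuantumFields.YangMills.Theorems.SwapVirialDeficitSectorLaplaceMbDensitySoftCeilHub
import Summits.QuantumFields.YangMills.Theorems.SwapVirialDeficitSectorLaplaceEndGaussShellPoint
import HarnessLib

/-!
# Route `SwapVirialDeficit` (YangMills): THE POINTWISE TIP∕SHELL COMPARABILITY OF THE MORSE–BOTT DENSITY in the hub letter `δ` — memo3 §5's sandwich closed:
# `𝔪(hubAt δ_t 1, ε, p)·δ_s ≤ R_L(p)·(1 + δ_t²)·𝔪(hubAt δ_s 1, ε, p)` off the corner `p ≠ 0`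
# (cell ym-idea-1, skeleton ➎, `stub_core_tip`: the hypothesis (H′) of w3 g68's δ-integration layer `tipMid_le_shell_of_pointwise`;
# free-hands support of ⟨stmt-QuantumFields-24197⟩ `SwapVirialDeficit.SwapGluedStiffness`)

For good signs `ε`, a base point `p = (x₀, y₀) ≠ 0` and two hubs `hubAt δ_t 1` (tip) and `hubAt δ_s 1` (shell) with `δ_s, δ_t ≥ δ_r ≥ 1` inside the one-loop matching window
`122689728·L⁴·δ_r⁻¹ ≤ μ_F∕(2·3|Fol L|)` (`μ_F = (2304L⁶|Fol L|)⁻¹`; hub angles `θ(δ) = arctan δ⁻¹ ≤ δ_r⁻¹`), ★★★ `mbDensity_hubAt_comparable`: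
`𝔪(hubAt δ_t 1, ε, p)·δ_s ≤ R_L(p)·(1 + δ_t²)·𝔪(hubAt δ_s 1, ε, p)` with the EXPLICIT
`R_L(p) = e^{1∕2}·(2(1+d)·122689728L⁴)·(2(1+d)·20400L⁴)^{5∕2}·(1+1∕d)^{d∕2}·(√(¼·(1800L⁶)⁻¹)³)⁻¹·(1800L⁶)²·2·(1+x₀²)²(1+y₀²)²∕(x₀²+y₀²)` (`d = 3|Fol L|`).
Three landed bricks and nothing else: the TIP ceiling ✓`mbDensity_angUnit_le_floorDet` (w2 g61; one soft pair, its `det M ≥ cos²θ_t sin²θ_t·|p|²∕((1800L⁶)²(1+x₀²)²(1+y₀²)²)`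
and `(cos²θ_t sin²θ_t)⁻¹ = (1+δ_t²)²∕δ_t² ≤ 2(1+δ_t²)`), the SHELL floor ✓`mbDensity_hubAt_ge_softCeil` (w3 g68; order `δ_s`), and the follower one-loop matching
✓`abs_log_det_gnoFolHessian_sub_le_joint` at `η = η′ = gnoBase p` with the hub-uniform base coercivity ✓`gnoFolHessian_coercive_base` (g48): `√det A_F^{s} ≤ e^{1∕2}√det A_F^{t}`.

HONEST LABEL: algebra on landed bricks; the δ-integration, corner `p → 0`, gnomonic ends, tip-core `δ > δ_b` and the assembly of `stub_core_tip`, `stub_end_gaussCore`, ⟨24197⟩ ∕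
⟨24194⟩ remain OPEN; own crux ⟨22884⟩ `LargeFieldMassRefinementTail` OPEN (blocked-on ⟨19935⟩); the Yang–Mills mass gap is NOT proved; no summit is proved by a line.
THEOREMS ONLY (0 `def`, 0 `sorry`, no instance), standard axioms.  Width seat ym-line-sfw-p2-w2 g61 (cell ym-idea-1, free hands), `--supports stmt-QuantumFields-24197`.
References: [cite: Luscher1983, §2]; [cite: Breitung1994, Lemma 26]; [folklore].
-/

set_option autoImplicit false
set_option synthInstance.maxSize 1024

noncomputable section

open MeasureTheory Quaternion Set Module
open scoped Quaternion BigOperators ENNReal InnerProductSpace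
open Literature.MathematicalPhysics.QuantumLattice
open Literature.MathematicalPhysics.QuantumFieldTheory hiding SU2

namespace Summit.QuantumFields.YangMills.Theorems.SwapVirialDeficit.SectorLaplace

open Summit.QuantumFields.YangMills.Theorems.FemtoTransferGap
open Summit.QuantumFields.YangMills.Theorems.FemtoTransferGap.TT
open Summit.QuantumFields.YangMills.Theorems.VirialFluxGap.RingDeficit
open Summit.QuantumFields.YangMills.Theorems.SwapVirialDeficit.SwapRing
open Summit.QuantumFields.YangMills.Theorems.SwapVirialDeficit.BlowUpRing

variable {L : ℕ} [NeZero L]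

omit [NeZero L] in
/-- The squared trigonometry of the hub angle: `sin²θ(δ) = (1+δ²)⁻¹`, `cos²θ(δ) = δ²∕(1+δ²)`. [folklore] -/
theorem sin_sq_cos_sq_hubAngle (δ : ℝ) :
    Real.sin (Real.pi / 2 - Real.arctan δ) ^ 2 = 1 / (1 + δ ^ 2) ∧ Real.cos (Real.pi / 2 - Real.arctan δ) ^ 2 = δ ^ 2 / (1 + δ ^ 2) := by
  have h1 : 0 ≤ 1 + δ ^ 2 := by positivity
  rw [sin_hubAngle, cos_hubAngle, inv_pow, Real.sq_sqrt h1, div_pow, Real.sq_sqrt h1, one_div]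
  exact ⟨rfl, rfl⟩

omit [NeZero L] in
/-- Two hub angles beyond `δ_r`: `|θ(δ) − θ(δ′)| ≤ δ_r⁻¹` for `δ, δ′ ≥ δ_r > 0` (`θ(δ) = arctan δ⁻¹ ∈ (0, δ_r⁻¹]`). [folklore] -/
theorem abs_hubAngle_sub_le_inv {δr δ δ' : ℝ} (hδr : 0 < δr) (hδ : δr ≤ δ) (hδ' : δr ≤ δ') :
    |(Real.pi / 2 - Real.arctan δ) - (Real.pi / 2 - Real.arctan δ')| ≤ δr⁻¹ := by
  have hδ0 : 0 < δ := lt_of_lt_of_le hδr hδ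
  have hδ0' : 0 < δ' := lt_of_lt_of_le hδr hδ'
  have hθ := hubAngle_le_inv hδ0
  have hθ' := hubAngle_le_inv hδ0'
  have hθ0 := (hubAngle_mem δ).1
  have hθ0' := (hubAngle_mem δ').1
  have hi : δ⁻¹ ≤ δr⁻¹ := inv_anti₀ hδr hδ
  have hi' : δ'⁻¹ ≤ δr⁻¹ := inv_anti₀ hδr hδ'
  rw [abs_sub_le_iff]
  constructor <;> linarith

/-- The structured-floor determinant of ✓`mbDensity_angUnit_le_floorDet` is bounded below by the soft pair alone:
`cos²θ·sin²θ·(x₀²+y₀²)∕((1800L⁶)²(1+x₀²)²(1+y₀²)²) ≤ det M(θ, p)`. [folklore] -/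
theorem floorDet_ge_softPair (θ : ℝ) (p : ℝ × ℝ) :
    Real.cos θ ^ 2 * Real.sin θ ^ 2 * (p.1 ^ 2 + p.2 ^ 2) / ((1800 * (L : ℝ) ^ 6) ^ 2 * (1 + p.1 ^ 2) ^ 2 * (1 + p.2 ^ 2) ^ 2) ≤
      ((1 / 4 : ℝ) * (16 * Real.cos θ ^ 2 * Real.sin θ ^ 2 / ((7200 * (L : ℝ) ^ 6) * (1 + p.1 ^ 2)))) * ((1 / 4 : ℝ) * (4 * Real.sin θ ^ 2 / ((1800 * (L : ℝ) ^ 6) * (1 + p.2 ^ 2)))) +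
        ((1 / 4 : ℝ) * (4 / ((1800 * (L : ℝ) ^ 6) * ((1 + p.1 ^ 2) * (1 + p.2 ^ 2))))) *
          (((1 / 4 : ℝ) * (16 * Real.cos θ ^ 2 * Real.sin θ ^ 2 / ((7200 * (L : ℝ) ^ 6) * (1 + p.1 ^ 2)))) * p.1 ^ 2 +
            ((1 / 4 : ℝ) * (4 * Real.sin θ ^ 2 / ((1800 * (L : ℝ) ^ 6) * (1 + p.2 ^ 2)))) * p.2 ^ 2) := by
  have hL : (0 : ℝ) < (L : ℝ) := Nat.cast_pos.2 (Nat.pos_of_ne_zero (NeZero.ne L))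
  set c2 : ℝ := Real.cos θ ^ 2 with hc2
  set s2 : ℝ := Real.sin θ ^ 2 with hs2
  set X : ℝ := 1 + p.1 ^ 2 with hX
  set Y : ℝ := 1 + p.2 ^ 2 with hY
  set K : ℝ := 1800 * (L : ℝ) ^ 6 with hK
  have hc0 : 0 ≤ c2 := sq_nonneg _
  have hs0 : 0 ≤ s2 := sq_nonneg _
  have hc1 : c2 ≤ 1 := by rw [hc2]; nlinarith [Real.cos_sq_add_sin_sq θ, sq_nonneg (Real.sin θ)]
  have hX1 : 1 ≤ X := by rw [hX]; nlinarith
  have hY1 : 1 ≤ Y := by rw [hY]; nlinarith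
  have hK0 : 0 < K := by rw [hK]; positivity
  -- normal form: `det M = s2/(K² X Y)·(c2 s2 + c2 x₀²/X + y₀²/Y)`
  have e : ((1 / 4 : ℝ) * (16 * c2 * s2 / ((7200 * (L : ℝ) ^ 6) * X))) * ((1 / 4 : ℝ) * (4 * s2 / (K * Y))) +
      ((1 / 4 : ℝ) * (4 / (K * (X * Y)))) * (((1 / 4 : ℝ) * (16 * c2 * s2 / ((7200 * (L : ℝ) ^ 6) * X))) * p.1 ^ 2 + ((1 / 4 : ℝ) * (4 * s2 / (K * Y))) * p.2 ^ 2) =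
      s2 / (K ^ 2 * X * Y) * (c2 * s2 + c2 * p.1 ^ 2 / X + p.2 ^ 2 / Y) := by
    rw [hK]; field_simp; ring
  rw [e]
  -- the soft pair: `c2 (x₀²+y₀²)/(X Y) ≤ c2 s2 + c2 x₀²/X + y₀²/Y`
  have h1 : c2 * (p.1 ^ 2 + p.2 ^ 2) / (X * Y) ≤ c2 * s2 + c2 * p.1 ^ 2 / X + p.2 ^ 2 / Y := by
    have ha : c2 * p.1 ^ 2 / (X * Y) ≤ c2 * p.1 ^ 2 / X :=
      div_le_div_of_nonneg_left (by positivity) (by positivity) (le_mul_of_one_le_right (by positivity) hY1)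
    have hb : c2 * p.2 ^ 2 / (X * Y) ≤ p.2 ^ 2 / Y := by
      calc c2 * p.2 ^ 2 / (X * Y) ≤ 1 * p.2 ^ 2 / (X * Y) := by gcongr
        _ ≤ 1 * p.2 ^ 2 / Y := div_le_div_of_nonneg_left (by positivity) (by positivity) (le_mul_of_one_le_left (by positivity) hX1)
        _ = p.2 ^ 2 / Y := by rw [one_mul]
    have hsplit : c2 * (p.1 ^ 2 + p.2 ^ 2) / (X * Y) = c2 * p.1 ^ 2 / (X * Y) + c2 * p.2 ^ 2 / (X * Y) := by ring
    rw [hsplit]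
    nlinarith [mul_nonneg hc0 hs0]
  calc c2 * s2 * (p.1 ^ 2 + p.2 ^ 2) / (K ^ 2 * X ^ 2 * Y ^ 2) = s2 / (K ^ 2 * X * Y) * (c2 * (p.1 ^ 2 + p.2 ^ 2) / (X * Y)) := by
        field_simp
    _ ≤ s2 / (K ^ 2 * X * Y) * (c2 * s2 + c2 * p.1 ^ 2 / X + p.2 ^ 2 / Y) := mul_le_mul_of_nonneg_left h1 (by positivity)

set_option maxHeartbeats 1600000 in
/-- ★★★ **THE POINTWISE TIP∕SHELL COMPARABILITY** (memo3 §5; hypothesis (H′) of w3 g68's `tipMid_le_shell_of_pointwise`).  Good signs, `p ≠ 0`, `1 ≤ δ_r ≤ δ_s, δ_t`,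
matching window `122689728·δ_r⁻¹·L⁴ ≤ μ_F∕(2·3|Fol L|)`.  Then
`𝔪(hubAt δ_t 1, ε, p)·δ_s ≤ R_L(p)·(1 + δ_t²)·𝔪(hubAt δ_s 1, ε, p)` with the explicit `R_L(p)` of the file header. [cite: Luscher1983, §2] [cite: Breitung1994, Lemma 26] -/
theorem mbDensity_hubAt_comparable {ε : GnoSign L} (hε : GoodSign ε) {δr δs δt : ℝ} (hδr : 1 ≤ δr) (hrs : δr ≤ δs) (hrt : δr ≤ δt)
    (hwin : 122689728 * δr⁻¹ * (L : ℝ) ^ 4 ≤ (2304 * (L : ℝ) ^ 6 * (Fintype.card (Fol L) : ℝ))⁻¹ / (2 * (3 * (Fintype.card (Fol L) : ℝ))))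
    (p : ℝ × ℝ) (hp : 0 < p.1 ^ 2 + p.2 ^ 2) :
    mbDensity (L := L) (hubAt δt 1) ε p * δs ≤
      (Real.exp (1 / 2) * (2 * ((1 + (finrank ℝ (GnoFol L) : ℝ)) * (122689728 * (L : ℝ) ^ 4))) *
          (2 * ((1 + (finrank ℝ (GnoFol L) : ℝ)) * (20400 * (L : ℝ) ^ 4))) ^ (5 / 2 : ℝ) *
          (1 + 1 / (finrank ℝ (GnoFol L) : ℝ)) ^ ((finrank ℝ (GnoFol L) : ℝ) / 2) *
          (Real.sqrt ((1 / 4 : ℝ) * (1 / (1800 * (L : ℝ) ^ 6))) ^ 3)⁻¹ *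
          ((1800 * (L : ℝ) ^ 6) ^ 2 * (1 + p.1 ^ 2) ^ 2 * (1 + p.2 ^ 2) ^ 2 * 2 / (p.1 ^ 2 + p.2 ^ 2))) *
        (1 + δt ^ 2) * mbDensity (L := L) (hubAt δs 1) ε p := by
  have hL : (0 : ℝ) < (L : ℝ) := Nat.cast_pos.2 (Nat.pos_of_ne_zero (NeZero.ne L))
  have hδr0 : 0 < δr := by linarith
  have hδs0 : 0 < δs := by linarith
  have hδt0 : 0 < δt := by linarith
  have hδs1 : 1 ≤ δs := hδr.trans hrs
  have hδt1 : 1 ≤ δt := hδr.trans hrt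
  set μ : ℝ := (2304 * (L : ℝ) ^ 6 * (Fintype.card (Fol L) : ℝ))⁻¹ with hμ
  have hμ0 : 0 < μ := (folMu_pos_le (L := L)).1
  set N : ℝ := (Fintype.card (Fol L) : ℝ) with hN
  have hN3 : (3 : ℝ) ≤ N := by
    have h := nine_le_finrank_gnoFol (L := L)
    rw [finrank_gnoFol_real] at h
    linarith
  -- dimensions (opaque)
  have hd9 := nine_le_finrank_gnoFol (L := L)
  obtain ⟨d, hd⟩ : ∃ d : ℝ, (finrank ℝ (GnoFol L) : ℝ) = d := ⟨_, rfl⟩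
  rw [hd] at hd9 ⊢
  have hdpos : 0 < d := by linarith
  -- the hub angles `θ(δ) = π/2 − arctan δ`
  obtain ⟨hst2, hct2⟩ := sin_sq_cos_sq_hubAngle δt
  have hsint : 0 < Real.sin (Real.pi / 2 - Real.arctan δt) := sin_hubAngle_pos δt
  have hsins : 0 < Real.sin (Real.pi / 2 - Real.arctan δs) := sin_hubAngle_pos δs
  have hcost : Real.cos (Real.pi / 2 - Real.arctan δt) ≠ 0 := by
    intro h
    have : Real.cos (Real.pi / 2 - Real.arctan δt) ^ 2 = 0 := by rw [h]; ring
    rw [hct2] at this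
    exact absurd this (by positivity)
  -- the two follower families (at the hubs `hubAt δt 1`, `hubAt δs 1`)
  obtain ⟨At, hAts, -, hAtyy, hAtray, hAtamb, -, -⟩ := exists_gnoFolHessian (fun _ => false) (fun _ => (1 : SU2)) (hubAt_one_ne_zero δt) ε
  obtain ⟨As, hAss, -, hAsyy, hAsray, hAsamb, -, -⟩ := exists_gnoFolHessian (fun _ => false) (fun _ => (1 : SU2)) (hubAt_one_ne_zero δs) ε
  set η₀ : GnoCoord L := gnoBase p.1 p.2 with hη₀
  set Dt : ℝ := Real.sqrt (LinearMap.det (At η₀)) with hDt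
  set Ds : ℝ := Real.sqrt (LinearMap.det (As η₀)) with hDs
  have hdett : μ ^ finrank ℝ (GnoFol L) ≤ LinearMap.det (At η₀) := det_gnoFolHessian_base_ge (hubAt_one_ne_zero δt) ε hε.1 hε.2 p.1 p.2 hAts hAtray
  have hdets : μ ^ finrank ℝ (GnoFol L) ≤ LinearMap.det (As η₀) := det_gnoFolHessian_base_ge (hubAt_one_ne_zero δs) ε hε.1 hε.2 p.1 p.2 hAss hAsray
  have hdett0 : 0 < LinearMap.det (At η₀) := lt_of_lt_of_le (by positivity) hdett
  have hdets0 : 0 < LinearMap.det (As η₀) := lt_of_lt_of_le (by positivity) hdets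
  have hDt0 : 0 < Dt := Real.sqrt_pos.2 hdett0
  have hDs0 : 0 < Ds := Real.sqrt_pos.2 hdets0
  -- §T the tip ceiling at `hubAt δt 1 ~ angUnit θt`
  have hAtyy' : ∀ η (y : GnoFol L), ⟪At η y, y⟫_ℝ =
      iteratedFDeriv ℝ 2 (fun y' : GnoFol L => gnoDeficit (fun _ => false) (fun _ => 1) (angUnit (Real.pi / 2 - Real.arctan δt)) ε (η + gnoFolEmb y')) 0
        (fun _ => y) := by
    intro η y
    rw [hAtyy η y]
    simp_rw [gnoDeficit_hubAt_eq_angUnit (fun _ => false) (fun _ => (1 : SU2)) δt ε]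
  have hT := mbDensity_angUnit_le_floorDet hcost hsint.ne' hε p hAts hAtyy'
  rw [mbDensity_angUnit_hubAngle] at hT
  -- §S the shell floor at `hubAt δs 1`
  have hS := mbDensity_hubAt_ge_softCeil hδs1 hε p hp hAss hAsyy
  rw [hd] at hS
  -- §M the one-loop matching of the follower determinants at the base point
  have eθt : gnoDeficit (fun _ => false) (fun _ => (1 : SU2)) (hubAt δt 1) ε =
      gnoDeficit (fun _ => false) (fun _ => 1) (angUnit (Real.pi / 2 - Real.arctan δt)) ε :=
    funext fun η => gnoDeficit_hubAt_eq_angUnit _ _ δt ε η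
  have eθs : gnoDeficit (fun _ => false) (fun _ => (1 : SU2)) (hubAt δs 1) ε =
      gnoDeficit (fun _ => false) (fun _ => 1) (angUnit (Real.pi / 2 - Real.arctan δs)) ε :=
    funext fun η => gnoDeficit_hubAt_eq_angUnit _ _ δs ε η
  have hambt : ∀ η (y : GnoFol L), ⟪At η y, y⟫_ℝ =
      iteratedFDeriv ℝ 2 (gnoDeficit (fun _ => false) (fun _ => 1) (angUnit (Real.pi / 2 - Real.arctan δt)) ε) η (fun _ => gnoFolEmb y) :=
    fun η y => by rw [← eθt]; exact hAtamb η y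
  have hambs : ∀ η (y : GnoFol L), ⟪As η y, y⟫_ℝ =
      iteratedFDeriv ℝ 2 (gnoDeficit (fun _ => false) (fun _ => 1) (angUnit (Real.pi / 2 - Real.arctan δs)) ε) η (fun _ => gnoFolEmb y) :=
    fun η y => by rw [← eθs]; exact hAsamb η y
  have hθθ : |(Real.pi / 2 - Real.arctan δs) - (Real.pi / 2 - Real.arctan δt)| ≤ δr⁻¹ := abs_hubAngle_sub_le_inv hδr0 hrs hrt
  have hwin' : 122689728 * |(Real.pi / 2 - Real.arctan δs) - (Real.pi / 2 - Real.arctan δt)| * (L : ℝ) ^ 4 ≤ μ / (2 * (3 * N)) :=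
    le_trans (by gcongr) hwin
  have hN6 : 1 ≤ 2 * (3 * N) := by linarith
  have hnear : (122689728 * |(Real.pi / 2 - Real.arctan δs) - (Real.pi / 2 - Real.arctan δt)| + 44712000 * ‖η₀ - η₀‖) * (L : ℝ) ^ 4 ≤ μ / 2 := by
    rw [sub_self, norm_zero, mul_zero, add_zero]
    refine hwin'.trans ?_
    rw [div_le_div_iff₀ (by positivity) (by norm_num)]
    nlinarith
  have hlog := abs_log_det_gnoFolHessian_sub_le_joint (fun _ => false) (fun _ => (1 : SU2)) hsins.le hsint.le ε hAss hAts hambs hambt hμ0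
    (gnoFolHessian_coercive_base (hubAt_one_ne_zero δt) ε hε.1 hε.2 p.1 p.2 hAtray) hnear
  rw [sub_self, norm_zero, mul_zero, add_zero] at hlog
  have hlog1 : Real.log (LinearMap.det (As η₀)) ≤ Real.log (LinearMap.det (At η₀)) + 1 := by
    have h1 : 2 * (3 * N) * (122689728 * |(Real.pi / 2 - Real.arctan δs) - (Real.pi / 2 - Real.arctan δt)| * (L : ℝ) ^ 4) / μ ≤ 1 := by
      rw [div_le_one hμ0]
      calc 2 * (3 * N) * (122689728 * |(Real.pi / 2 - Real.arctan δs) - (Real.pi / 2 - Real.arctan δt)| * (L : ℝ) ^ 4)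
          ≤ 2 * (3 * N) * (μ / (2 * (3 * N))) := by gcongr
        _ = μ := by field_simp
    have h2 := (abs_sub_le_iff.1 hlog).1
    linarith
  have hM : Ds ≤ Real.exp (1 / 2) * Dt := by
    have h1 : LinearMap.det (As η₀) ≤ Real.exp 1 * LinearMap.det (At η₀) := by
      rw [← Real.exp_log hdets0, ← Real.exp_log hdett0, ← Real.exp_add, add_comm]
      exact Real.exp_le_exp.2 hlog1
    have h2 : Real.exp 1 = Real.exp (1 / 2) ^ 2 := by rw [← Real.exp_nat_mul]; norm_num
    calc Ds = Real.sqrt (LinearMap.det (As η₀)) := hDs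
      _ ≤ Real.sqrt (Real.exp 1 * LinearMap.det (At η₀)) := Real.sqrt_le_sqrt h1
      _ = Real.exp (1 / 2) * Dt := by rw [Real.sqrt_mul (Real.exp_pos _).le, h2, Real.sqrt_sq (Real.exp_pos _).le, hDt]
  -- §D the soft pair of the structured floor and `(cos²θt sin²θt)⁻¹ ≤ 2(1+δt²)`
  have hD := floorDet_ge_softPair (L := L) (Real.pi / 2 - Real.arctan δt) p
  set D : ℝ := ((1 / 4 : ℝ) * (16 * Real.cos (Real.pi / 2 - Real.arctan δt) ^ 2 * Real.sin (Real.pi / 2 - Real.arctan δt) ^ 2 / ((7200 * (L : ℝ) ^ 6) * (1 + p.1 ^ 2)))) *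
        ((1 / 4 : ℝ) * (4 * Real.sin (Real.pi / 2 - Real.arctan δt) ^ 2 / ((1800 * (L : ℝ) ^ 6) * (1 + p.2 ^ 2)))) +
        ((1 / 4 : ℝ) * (4 / ((1800 * (L : ℝ) ^ 6) * ((1 + p.1 ^ 2) * (1 + p.2 ^ 2))))) *
          (((1 / 4 : ℝ) * (16 * Real.cos (Real.pi / 2 - Real.arctan δt) ^ 2 * Real.sin (Real.pi / 2 - Real.arctan δt) ^ 2 / ((7200 * (L : ℝ) ^ 6) * (1 + p.1 ^ 2)))) * p.1 ^ 2 +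
            ((1 / 4 : ℝ) * (4 * Real.sin (Real.pi / 2 - Real.arctan δt) ^ 2 / ((1800 * (L : ℝ) ^ 6) * (1 + p.2 ^ 2)))) * p.2 ^ 2) with hDdef
  have hcs : Real.cos (Real.pi / 2 - Real.arctan δt) ^ 2 * Real.sin (Real.pi / 2 - Real.arctan δt) ^ 2 = δt ^ 2 / (1 + δt ^ 2) ^ 2 := by
    rw [hct2, hst2]; field_simp
  rw [hcs] at hD
  have hD0 : 0 < D := lt_of_lt_of_le (by positivity) hD
  set Z : ℝ := Real.sqrt ((1 / 4 : ℝ) * (1 / (1800 * (L : ℝ) ^ 6))) ^ 3 with hZ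
  have hZ0 : 0 < Z := by rw [hZ]; positivity
  set ρ₀ : ℝ := gnoDensity (gnoBase p.1 p.2 : GnoCoord L) with hρ₀
  have hρ0 : 0 < ρ₀ := gnoDensity_pos _
  set W : ℝ := (1800 * (L : ℝ) ^ 6) ^ 2 * (1 + p.1 ^ 2) ^ 2 * (1 + p.2 ^ 2) ^ 2 with hW
  have hW0 : 0 < W := by rw [hW]; positivity
  have hDinv : 1 / D ≤ W * (2 * (1 + δt ^ 2)) / (p.1 ^ 2 + p.2 ^ 2) := by
    -- `|p|² ≤ D·W·(1+δt²)²/δt²` and `(1+δt²)²/δt² ≤ 2(1+δt²)`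
    have h1 : δt ^ 2 / (1 + δt ^ 2) ^ 2 * (p.1 ^ 2 + p.2 ^ 2) / W ≤ D := by rw [hW]; exact hD
    have h2 : (1 + δt ^ 2) ^ 2 / δt ^ 2 ≤ 2 * (1 + δt ^ 2) := by
      rw [div_le_iff₀ (by positivity)]
      have hx : 1 ≤ δt ^ 2 := by nlinarith
      have hprod : 0 ≤ (1 + δt ^ 2) * (δt ^ 2 - 1) := mul_nonneg (by positivity) (by linarith)
      nlinarith [hprod]
    rw [div_le_div_iff₀ hD0 hp, one_mul]
    have h3 : p.1 ^ 2 + p.2 ^ 2 ≤ D * W * ((1 + δt ^ 2) ^ 2 / δt ^ 2) := by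
      have h1' := (div_le_iff₀ hW0).1 h1
      have e : δt ^ 2 / (1 + δt ^ 2) ^ 2 * (p.1 ^ 2 + p.2 ^ 2) * ((1 + δt ^ 2) ^ 2 / δt ^ 2) = p.1 ^ 2 + p.2 ^ 2 := by
        field_simp
      calc p.1 ^ 2 + p.2 ^ 2 = δt ^ 2 / (1 + δt ^ 2) ^ 2 * (p.1 ^ 2 + p.2 ^ 2) * ((1 + δt ^ 2) ^ 2 / δt ^ 2) := e.symm
        _ ≤ D * W * ((1 + δt ^ 2) ^ 2 / δt ^ 2) := by gcongr
    calc p.1 ^ 2 + p.2 ^ 2 ≤ D * W * ((1 + δt ^ 2) ^ 2 / δt ^ 2) := h3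
      _ ≤ D * W * (2 * (1 + δt ^ 2)) := by gcongr
      _ = W * (2 * (1 + δt ^ 2)) * D := by ring
  -- §A assembly
  set C1 : ℝ := 2 * ((1 + d) * (122689728 * (L : ℝ) ^ 4)) with hC1
  set C2 : ℝ := (2 * ((1 + d) * (20400 * (L : ℝ) ^ 4))) ^ (-(5 / 2 : ℝ)) with hC2
  set C3 : ℝ := (1 + 1 / d) ^ (-(d / 2)) with hC3
  have hC10 : 0 < C1 := by rw [hC1]; positivity
  have hC20 : 0 < C2 := by rw [hC2]; exact Real.rpow_pos_of_pos (by positivity) _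
  have hC30 : 0 < C3 := by rw [hC3]; exact Real.rpow_pos_of_pos (by positivity) _
  have hC2inv : C2⁻¹ = (2 * ((1 + d) * (20400 * (L : ℝ) ^ 4))) ^ (5 / 2 : ℝ) := by
    rw [hC2, Real.rpow_neg (by positivity), inv_inv]
  have hC3inv : C3⁻¹ = (1 + 1 / d) ^ (d / 2) := by
    rw [hC3, Real.rpow_neg (by positivity), inv_inv]
  -- (S) in product form: `ρ₀ · δs ≤ ms · Ds · C1/(C2 C3)`
  have hS' : ρ₀ * ((2 * ((1 + d) * (122689728 * (L : ℝ) ^ 4 * δs⁻¹)))⁻¹ * C2 * C3 / Ds) ≤ mbDensity (L := L) (hubAt δs 1) ε p := hS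
  have hCδ : (2 * ((1 + d) * (122689728 * (L : ℝ) ^ 4 * δs⁻¹)))⁻¹ = δs / C1 := by
    rw [hC1]; field_simp
  rw [hCδ] at hS'
  have hms0 : 0 ≤ mbDensity (L := L) (hubAt δs 1) ε p := le_trans (by positivity) hS'
  have hρδ : ρ₀ * δs ≤ mbDensity (L := L) (hubAt δs 1) ε p * (Ds * C1 / (C2 * C3)) := by
    have e : ρ₀ * (δs / C1 * C2 * C3 / Ds) * (Ds * C1 / (C2 * C3)) = ρ₀ * δs := by field_simp
    rw [← e]
    exact mul_le_mul_of_nonneg_right hS' (by positivity)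
  -- (T): `mt ≤ ρ₀/(Z D Dt)`
  have hT' : mbDensity (L := L) (hubAt δt 1) ε p ≤ ρ₀ / (Z * D * Dt) := hT
  calc mbDensity (L := L) (hubAt δt 1) ε p * δs ≤ ρ₀ / (Z * D * Dt) * δs := mul_le_mul_of_nonneg_right hT' hδs0.le
    _ = ρ₀ * δs / (Z * D * Dt) := by ring
    _ ≤ mbDensity (L := L) (hubAt δs 1) ε p * (Ds * C1 / (C2 * C3)) / (Z * D * Dt) := by gcongr
    _ = mbDensity (L := L) (hubAt δs 1) ε p * (Ds / Dt) * C1 / (C2 * C3) * (1 / D) / Z := by field_simp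
    _ ≤ mbDensity (L := L) (hubAt δs 1) ε p * Real.exp (1 / 2) * C1 / (C2 * C3) * (W * (2 * (1 + δt ^ 2)) / (p.1 ^ 2 + p.2 ^ 2)) / Z := by
        have h1 : Ds / Dt ≤ Real.exp (1 / 2) := (div_le_iff₀ hDt0).2 hM
        gcongr
    _ = (Real.exp (1 / 2) * C1 * C2⁻¹ * C3⁻¹ * Z⁻¹ * (W * 2 / (p.1 ^ 2 + p.2 ^ 2))) * (1 + δt ^ 2) * mbDensity (L := L) (hubAt δs 1) ε p := by
        field_simp
    _ = _ := by rw [hC2inv, hC3inv, hC1, hZ, hW]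

end Summit.QuantumFields.YangMills.Theorems.SwapVirialDeficit.SectorLaplace

end
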